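import Mathlib.Analysis.SpecialFunctions.Log.Base
import Mathlib.Analysis.SpecialFunctions.Pow.Real
import Mathlib.Analysis.SpecialFunctions.Pow.Asymptotics
import Mathlib.Analysis.SpecificLimits.Basic
import Summits.CriticalPhenomena.Ising3DConformalLimit.Theorems.ExistsScaleCovariantLimit.Negative.DyadicTwoPrimesDensity
import HarnessLib

/-!
# `JoiningsTransfer` (item stmt-CriticalPhenomena-18764): the two-base Croft lemma HOLDS — the
load-bearing analysis of `Negative/TwoBaseCroftMutations.lean` is tight

Negative / structural knowledge for the crux
`Summit.CriticalPhenomena.Ising3DConformalLimit.Theses.SynchronousCoupling.JoiningsTransfer` (standing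
crux disprover, cycle 1, D-0016); THEOREM-ONLY (tower limits are written as the term
`limUnder atTop (fun j => R (p^j L))`; no definitions, no notation, no named facts), pure
Mathlib plus the landed `dense_closure_log_two_log_three`. No theorem here asserts a route item.

`twoBaseCroft` — the abstract skeleton of the transfer `DilationJoinings → (PL)`, i.e. the first lemma
`TwoBaseCroft` of the crux idea `towers-to-all-scales-croft` VERBATIM: for `R : ℕ → ℝ`, power-rate towers
for BOTH bases (`|R(2L) − R(L)|, |R(3L) − R(L)| ≤ C·L^{-θ}`, `L ≥ 1`, `θ > 0`) and log-scale asymptotic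
continuity (`∀ ε>0 ∃ s>0 ∃ L₀ ∀ L₀ ≤ L ≤ L' ≤ (1+s)L, |R L' − R L| ≤ ε`) imply that `R` converges. Together
with the three refuted mutations (`not_twoBaseCroft_without_three`, `…_without_logContinuity`,
`…_littleO`) this pins the skeleton exactly: each hypothesis necessary, all three sufficient.

Proof. `tendsto_towerLim`/`abs_sub_towerLim_le`: the tower `j ↦ R(p^j L)` is geometrically Cauchy,
with limit `T_p(L)` and `|R L − T_p L| ≤ C L^{-θ}/(1 − p^{-θ})`; `towerLim_mul`: `T_p(pL) = T_p(L)`;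
`towerLim_logContinuous`: log-continuity passes to `T_p` at EVERY scale (towers escape to `∞`). Then
`|T₂ − T₃| ≤ K L^{-θ}` makes `T₂` approximately `3`-invariant (`2K L^{-θ}`), density of
`ℤ log 2 + ℤ log 3` (`dense_closure_log_two_log_three`, `AddSubgroup.mem_closure_pair`) moves any two
scales to comparable ones `2^{u⁺}3^{v⁺}L ≈ 2^{u⁻}3^{v⁻}L'` (`log_ratio_eq`), whence
`|T₂ L − T₂ L'| ≤ 2K(L^{-θ} + L'^{-θ})`: `T₂` is Cauchy and `R − T₂ → 0`. [folklore]
-/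

noncomputable section

namespace Summit.CriticalPhenomena.Ising3DConformalLimit.JoiningsTransferNegative

open Filter Set
open scoped Topology
open Summit.CriticalPhenomena.Ising3DConformalLimit.ExistsScaleCovariantLimitNegative.Dyadic
  (dense_closure_log_two_log_three)

/-! ### Towers for one base `p ≥ 2` -/

section Tower

variable {R : ℕ → ℝ} {C θ : ℝ} {p : ℕ}


/-- `p^{-θ} < 1` for `p ≥ 2`, `θ > 0`. [folklore] -/
theorem rpow_neg_lt_one (hp : 2 ≤ p) (hθ : 0 < θ) : ((p:ℝ)) ^ (-θ) < 1 :=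
  Real.rpow_lt_one_of_one_lt_of_neg (by exact_mod_cast (lt_of_lt_of_le one_lt_two hp)) (by linarith)

/-- One step of the tower: `dist (R(p^j L)) (R(p^{j+1} L)) ≤ (C L^{-θ})·(p^{-θ})^j`. [folklore] -/
theorem tower_step (hp : 2 ≤ p)
    (hT : ∀ L : ℕ, 1 ≤ L → |R (p * L) - R L| ≤ C * (L:ℝ) ^ (-θ)) {L : ℕ} (hL : 1 ≤ L) (j : ℕ) :
    dist (R (p ^ j * L)) (R (p ^ (j + 1) * L)) ≤ C * (L:ℝ) ^ (-θ) * (((p:ℝ) ^ (-θ)) ^ j) := by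
  have hp0 : (0:ℝ) ≤ p := Nat.cast_nonneg p
  have hL0 : (0:ℝ) ≤ L := Nat.cast_nonneg L
  have hLj : 1 ≤ p ^ j * L := one_le_mul (Nat.one_le_pow _ _ (lt_of_lt_of_le two_pos hp)) hL
  have h1 : p ^ (j + 1) * L = p * (p ^ j * L) := by ring
  rw [h1, Real.dist_eq, abs_sub_comm]
  refine (hT _ hLj).trans (le_of_eq ?_)
  rw [Nat.cast_mul, Nat.cast_pow, Real.mul_rpow (by positivity) hL0, ← Real.rpow_natCast,
    ← Real.rpow_mul hp0, mul_comm (j:ℝ), Real.rpow_mul_natCast hp0]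
  ring

/-- The tower is Cauchy. [folklore] -/
theorem tower_cauchySeq (hp : 2 ≤ p) (hθ : 0 < θ)
    (hT : ∀ L : ℕ, 1 ≤ L → |R (p * L) - R L| ≤ C * (L:ℝ) ^ (-θ)) {L : ℕ} (hL : 1 ≤ L) :
    CauchySeq (fun j : ℕ => R (p ^ j * L)) :=
  cauchySeq_of_le_geometric _ _ (rpow_neg_lt_one hp hθ) (tower_step hp hT hL)

/-- The tower converges to its `limUnder`. [folklore] -/
theorem tendsto_towerLim (hp : 2 ≤ p) (hθ : 0 < θ)
    (hT : ∀ L : ℕ, 1 ≤ L → |R (p * L) - R L| ≤ C * (L:ℝ) ^ (-θ)) {L : ℕ} (hL : 1 ≤ L) :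
    Tendsto (fun j : ℕ => R (p ^ j * L)) atTop (𝓝 (limUnder atTop (fun j : ℕ => R (p ^ j * L)))) :=
  tendsto_nhds_limUnder (cauchySeq_tendsto_of_complete (tower_cauchySeq hp hθ hT hL))

/-- `|R L − T_p L| ≤ C L^{-θ} / (1 − p^{-θ})`. [folklore] -/
theorem abs_sub_towerLim_le (hp : 2 ≤ p) (hθ : 0 < θ)
    (hT : ∀ L : ℕ, 1 ≤ L → |R (p * L) - R L| ≤ C * (L:ℝ) ^ (-θ)) {L : ℕ} (hL : 1 ≤ L) :
    |R L - limUnder atTop (fun j : ℕ => R (p ^ j * L))| ≤ C / (1 - (p:ℝ) ^ (-θ)) * (L:ℝ) ^ (-θ) := by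
  have h := dist_le_of_le_geometric_of_tendsto₀ _ _ (rpow_neg_lt_one hp hθ) (tower_step hp hT hL)
    (tendsto_towerLim hp hθ hT hL)
  simp only [pow_zero, one_mul, Real.dist_eq] at h
  calc |R L - limUnder atTop (fun j : ℕ => R (p ^ j * L))| ≤ C * (L:ℝ) ^ (-θ) / (1 - (p:ℝ) ^ (-θ)) := h
    _ = C / (1 - (p:ℝ) ^ (-θ)) * (L:ℝ) ^ (-θ) := by ring

/-- Exact `p`-invariance of the tower limit. [folklore] -/
theorem towerLim_mul (hp : 2 ≤ p) (hθ : 0 < θ)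
    (hT : ∀ L : ℕ, 1 ≤ L → |R (p * L) - R L| ≤ C * (L:ℝ) ^ (-θ)) {L : ℕ} (hL : 1 ≤ L) :
    limUnder atTop (fun j : ℕ => R (p ^ j * (p * L))) = limUnder atTop (fun j : ℕ => R (p ^ j * L)) := by
  have h1 : Tendsto (fun j : ℕ => R (p ^ j * (p * L))) atTop (𝓝 (limUnder atTop (fun j : ℕ => R (p ^ j * (p * L))))) :=
    tendsto_towerLim hp hθ hT (one_le_mul (le_trans one_le_two hp) hL)
  have h2 : Tendsto (fun j : ℕ => R (p ^ (j + 1) * L)) atTop (𝓝 (limUnder atTop (fun j : ℕ => R (p ^ j * L)))) :=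
    (tendsto_towerLim hp hθ hT hL).comp (tendsto_add_atTop_nat 1)
  have h1' : Tendsto (fun j : ℕ => R (p ^ (j + 1) * L)) atTop (𝓝 (limUnder atTop (fun j : ℕ => R (p ^ j * (p * L))))) :=
    h1.congr fun j => by
      show R (p ^ j * (p * L)) = R (p ^ (j + 1) * L)
      congr 1; ring
  exact tendsto_nhds_unique h1' h2

/-- Exact `p^a`-invariance of the tower limit. [folklore] -/
theorem towerLim_pow_mul (hp : 2 ≤ p) (hθ : 0 < θ)
    (hT : ∀ L : ℕ, 1 ≤ L → |R (p * L) - R L| ≤ C * (L:ℝ) ^ (-θ)) {L : ℕ} (hL : 1 ≤ L) (a : ℕ) :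
    limUnder atTop (fun j : ℕ => R (p ^ j * (p ^ a * L))) = limUnder atTop (fun j : ℕ => R (p ^ j * L)) := by
  induction a with
  | zero => simp
  | succ a ih =>
      rw [pow_succ, mul_comm (p ^ a) p, mul_assoc, towerLim_mul hp hθ hT (one_le_mul
        (Nat.one_le_pow _ _ (lt_of_lt_of_le two_pos hp)) hL), ih]

/-- Log-continuity passes to the tower limit, at EVERY scale `L ≥ 1` (the tower escapes to `∞`). [folklore] -/
theorem towerLim_logContinuous (hp : 2 ≤ p) (hθ : 0 < θ)
    (hT : ∀ L : ℕ, 1 ≤ L → |R (p * L) - R L| ≤ C * (L:ℝ) ^ (-θ))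
    {ε s : ℝ} {L₀ : ℕ} (hLC : ∀ L L' : ℕ, L₀ ≤ L → L ≤ L' → (L':ℝ) ≤ (1+s)*L → |R L' - R L| ≤ ε)
    {L L' : ℕ} (hL : 1 ≤ L) (hLL' : L ≤ L') (hL's : (L':ℝ) ≤ (1+s)*L) :
    |limUnder atTop (fun j : ℕ => R (p ^ j * L')) - limUnder atTop (fun j : ℕ => R (p ^ j * L))| ≤ ε := by
  have hL' : 1 ≤ L' := le_trans hL hLL'
  have hlim : Tendsto (fun j : ℕ => R (p ^ j * L') - R (p ^ j * L)) atTop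
      (𝓝 (limUnder atTop (fun j : ℕ => R (p ^ j * L')) - limUnder atTop (fun j : ℕ => R (p ^ j * L)))) :=
    (tendsto_towerLim hp hθ hT hL').sub (tendsto_towerLim hp hθ hT hL)
  have hev : ∀ᶠ j : ℕ in atTop, |R (p ^ j * L') - R (p ^ j * L)| ≤ ε := by
    -- `p^j L ≥ L₀` eventually since `p^j → ∞`
    have hpj : Tendsto (fun j : ℕ => p ^ j * L) atTop atTop :=
      tendsto_atTop_mono (fun j => Nat.le_mul_of_pos_right _ hL)
        (tendsto_pow_atTop_atTop_of_one_lt (lt_of_lt_of_le one_lt_two hp))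
    filter_upwards [hpj.eventually_ge_atTop L₀] with j hj
    refine hLC _ _ hj (Nat.mul_le_mul_left _ hLL') ?_
    push_cast
    have : (0:ℝ) ≤ (p:ℝ) ^ j := by positivity
    nlinarith
  exact abs_le.2 ⟨ge_of_tendsto hlim (hev.mono fun j hj => (abs_le.1 hj).1),
    le_of_tendsto hlim (hev.mono fun j hj => (abs_le.1 hj).2)⟩

end Tower

/-! ### Two bases -/

/-- Bookkeeping: `2^{u⁺} 3^{v⁺} L` and `2^{u⁻} 3^{v⁻} L'` have log-ratio `u log 2 + v log 3 + log L − log L'`. [folklore] -/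
theorem log_ratio_eq (u v : ℤ) {L L' : ℕ} (hL : 1 ≤ L) (hL' : 1 ≤ L') :
    Real.log ((2 ^ u.toNat * 3 ^ v.toNat * L : ℕ) : ℝ) - Real.log ((2 ^ (-u).toNat * 3 ^ (-v).toNat * L' : ℕ) : ℝ)
      = u * Real.log 2 + v * Real.log 3 + (Real.log L - Real.log L') := by
  have hL0 : (0:ℝ) < L := by exact_mod_cast hL
  have hL'0 : (0:ℝ) < L' := by exact_mod_cast hL'
  push_cast
  rw [Real.log_mul (by positivity) hL0.ne', Real.log_mul (by positivity) (by positivity),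
    Real.log_mul (by positivity) hL'0.ne', Real.log_mul (by positivity) (by positivity),
    Real.log_pow, Real.log_pow, Real.log_pow, Real.log_pow]
  have hu : ((u.toNat : ℕ) : ℝ) - (((-u).toNat : ℕ) : ℝ) = (u : ℝ) := by
    have := Int.toNat_sub_toNat_neg u
    exact_mod_cast this
  have hv : ((v.toNat : ℕ) : ℝ) - (((-v).toNat : ℕ) : ℝ) = (v : ℝ) := by
    have := Int.toNat_sub_toNat_neg v
    exact_mod_cast this
  linear_combination Real.log 2 * hu + Real.log 3 * hv

/-- From `|log N − log N'| ≤ log (1+s)`: `N' ≤ (1+s) N`. [folklore] -/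
theorem le_mul_of_abs_log_sub_le {N N' : ℕ} {s : ℝ} (hs : 0 < s) (hN : 1 ≤ N) (hN' : 1 ≤ N')
    (h : |Real.log (N:ℝ) - Real.log (N':ℝ)| ≤ Real.log (1 + s)) : (N':ℝ) ≤ (1 + s) * N := by
  have hN0 : (0:ℝ) < N := by exact_mod_cast hN
  have hN'0 : (0:ℝ) < N' := by exact_mod_cast hN'
  have h1 : Real.log (N':ℝ) - Real.log (N:ℝ) ≤ Real.log (1 + s) := by
    have := (abs_le.1 h).1; linarith
  have h2 : Real.log (N':ℝ) ≤ Real.log ((1 + s) * N) := by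
    rw [Real.log_mul (by positivity) hN0.ne']; linarith
  exact (Real.log_le_log_iff hN'0 (by positivity)).1 h2

/-- **The two-base Croft lemma** (first lemma `TwoBaseCroft` of idea `towers-to-all-scales-croft`,
verbatim). [folklore] -/
theorem twoBaseCroft : ∀ R : ℕ → ℝ, (∃ C θ : ℝ, 0 < θ ∧ ∀ L : ℕ, 1 ≤ L → |R (2*L) - R L| ≤ C * (L:ℝ)^(-θ) ∧ |R (3*L) - R L| ≤ C * (L:ℝ)^(-θ)) → (∀ ε : ℝ, 0 < ε → ∃ s : ℝ, 0 < s ∧ ∃ L₀ : ℕ, ∀ L L' : ℕ, L₀ ≤ L → L ≤ L' → (L':ℝ) ≤ (1+s)*L → |R L' - R L| ≤ ε) → ∃ M : ℝ, Filter.Tendsto R Filter.atTop (nhds M) := by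
  intro R ⟨C, θ, hθ, hT⟩ hLC
  have hT2 : ∀ L : ℕ, 1 ≤ L → |R (2 * L) - R L| ≤ C * (L:ℝ) ^ (-θ) := fun L hL => (hT L hL).1
  have hT3 : ∀ L : ℕ, 1 ≤ L → |R (3 * L) - R L| ≤ C * (L:ℝ) ^ (-θ) := fun L hL => (hT L hL).2
  -- constants
  set C₂ : ℝ := C / (1 - (2:ℕ) ^ (-θ)) with hC₂
  set C₃ : ℝ := C / (1 - (3:ℕ) ^ (-θ)) with hC₃
  have hC : 0 ≤ C := by
    have := (hT 1 le_rfl).1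
    simp only [Nat.cast_one, Real.one_rpow, mul_one] at this
    exact (abs_nonneg _).trans this
  have hC₂0 : 0 ≤ C₂ := div_nonneg hC (sub_nonneg.2 (rpow_neg_lt_one (p := 2) le_rfl hθ).le)
  have hC₃0 : 0 ≤ C₃ := div_nonneg hC (sub_nonneg.2 (rpow_neg_lt_one (p := 3) (by norm_num) hθ).le)
  set K : ℝ := C₂ + C₃ with hK
  have hK0 : 0 ≤ K := add_nonneg hC₂0 hC₃0
  have d2 : ∀ L : ℕ, 1 ≤ L → |R L - limUnder atTop (fun j : ℕ => R (2 ^ j * L))| ≤ C₂ * (L:ℝ) ^ (-θ) := fun L hL =>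
    abs_sub_towerLim_le (p := 2) le_rfl hθ hT2 hL
  have d3 : ∀ L : ℕ, 1 ≤ L → |R L - limUnder atTop (fun j : ℕ => R (3 ^ j * L))| ≤ C₃ * (L:ℝ) ^ (-θ) := fun L hL =>
    abs_sub_towerLim_le (p := 3) (by norm_num) hθ hT3 hL
  have d23 : ∀ L : ℕ, 1 ≤ L → |limUnder atTop (fun j : ℕ => R (2 ^ j * L)) - limUnder atTop (fun j : ℕ => R (3 ^ j * L))| ≤ K * (L:ℝ) ^ (-θ) := fun L hL => by
    have h1 := d2 L hL; have h2 := d3 L hL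
    rw [abs_le] at h1 h2 ⊢
    constructor <;> nlinarith
  -- monotonicity of `L ↦ L^{-θ}` on `L ≥ 1`
  have rpow_anti : ∀ {L N : ℕ}, 1 ≤ L → L ≤ N → (N:ℝ) ^ (-θ) ≤ (L:ℝ) ^ (-θ) := fun {L N} hL hLN =>
    Real.rpow_le_rpow_of_nonpos (by exact_mod_cast hL) (by exact_mod_cast hLN) (by linarith)
  -- `towerLim 2 R` is approximately `3`-invariant and exactly `2`-invariant
  have T2_three : ∀ L : ℕ, 1 ≤ L → ∀ b : ℕ, |limUnder atTop (fun j : ℕ => R (2 ^ j * (3 ^ b * L))) - limUnder atTop (fun j : ℕ => R (2 ^ j * L))| ≤ 2 * K * (L:ℝ) ^ (-θ) := by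
    intro L hL b
    have hbL : 1 ≤ 3 ^ b * L := one_le_mul (Nat.one_le_pow _ _ (by norm_num)) hL
    have h1 := d23 (3 ^ b * L) hbL
    have h2 : limUnder atTop (fun j : ℕ => R (3 ^ j * (3 ^ b * L))) = limUnder atTop (fun j : ℕ => R (3 ^ j * L)) := towerLim_pow_mul (p := 3) (by norm_num) hθ hT3 hL b
    have h3 := d23 L hL
    have h4 : ((3 ^ b * L : ℕ) : ℝ) ^ (-θ) ≤ (L:ℝ) ^ (-θ) := rpow_anti hL (Nat.le_mul_of_pos_left L (by positivity))
    rw [h2] at h1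
    rw [abs_le] at h1 h3 ⊢
    constructor <;> nlinarith
  have T2_two_three : ∀ L : ℕ, 1 ≤ L → ∀ a b : ℕ, |limUnder atTop (fun j : ℕ => R (2 ^ j * (2 ^ a * 3 ^ b * L))) - limUnder atTop (fun j : ℕ => R (2 ^ j * L))| ≤ 2 * K * (L:ℝ) ^ (-θ) := by
    intro L hL a b
    have hbL : 1 ≤ 3 ^ b * L := one_le_mul (Nat.one_le_pow _ _ (by norm_num)) hL
    rw [mul_assoc, towerLim_pow_mul (p := 2) le_rfl hθ hT2 hbL a]
    exact T2_three L hL b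
  -- KEY: `towerLim 2 R` is Cauchy-like with an explicit modulus
  have key : ∀ L L' : ℕ, 1 ≤ L → 1 ≤ L' → |limUnder atTop (fun j : ℕ => R (2 ^ j * L)) - limUnder atTop (fun j : ℕ => R (2 ^ j * L'))| ≤ 2 * K * ((L:ℝ) ^ (-θ) + (L':ℝ) ^ (-θ)) := by
    intro L L' hL hL'
    refine le_of_forall_pos_le_add fun ε hε => ?_
    obtain ⟨s, hs, L₀, hcont⟩ := hLC ε hε
    -- density: integers `u, v` with `|u log 2 + v log 3 + (log L − log L')| < log (1+s)`
    have hlog : 0 < Real.log (1 + s) := Real.log_pos (by linarith)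
    obtain ⟨g, hg, hdist⟩ := dense_closure_log_two_log_three.exists_dist_lt (-(Real.log L - Real.log L')) hlog
    obtain ⟨u, v, huv⟩ := AddSubgroup.mem_closure_pair.1 hg
    set N : ℕ := 2 ^ u.toNat * 3 ^ v.toNat * L with hN
    set N' : ℕ := 2 ^ (-u).toNat * 3 ^ (-v).toNat * L' with hN'
    have hN1 : 1 ≤ N := one_le_mul (one_le_mul (Nat.one_le_two_pow) (Nat.one_le_pow _ _ (by norm_num))) hL
    have hN'1 : 1 ≤ N' := one_le_mul (one_le_mul (Nat.one_le_two_pow) (Nat.one_le_pow _ _ (by norm_num))) hL'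
    have hratio : |Real.log (N:ℝ) - Real.log (N':ℝ)| ≤ Real.log (1 + s) := by
      rw [hN, hN', log_ratio_eq u v hL hL']
      rw [Real.dist_eq] at hdist
      have : (u:ℝ) * Real.log 2 + v * Real.log 3 = g := by rw [← huv]; simp [zsmul_eq_mul]
      rw [this]
      have h' : |-(Real.log ↑L - Real.log ↑L') - g| = |g + (Real.log ↑L - Real.log ↑L')| := by
        rw [← abs_neg]; congr 1; ring
      linarith [h'.symm ▸ hdist.le]
    have hA : |limUnder atTop (fun j : ℕ => R (2 ^ j * N)) - limUnder atTop (fun j : ℕ => R (2 ^ j * L))| ≤ 2 * K * (L:ℝ) ^ (-θ) := T2_two_three L hL _ _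
    have hB : |limUnder atTop (fun j : ℕ => R (2 ^ j * N')) - limUnder atTop (fun j : ℕ => R (2 ^ j * L'))| ≤ 2 * K * (L':ℝ) ^ (-θ) := T2_two_three L' hL' _ _
    have hmid : |limUnder atTop (fun j : ℕ => R (2 ^ j * N)) - limUnder atTop (fun j : ℕ => R (2 ^ j * N'))| ≤ ε := by
      rcases le_total N N' with h | h
      · rw [abs_sub_comm]
        exact towerLim_logContinuous (p := 2) le_rfl hθ hT2 hcont hN1 h
          (le_mul_of_abs_log_sub_le hs hN1 hN'1 hratio)
      · refine towerLim_logContinuous (p := 2) le_rfl hθ hT2 hcont hN'1 h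
          (le_mul_of_abs_log_sub_le hs hN'1 hN1 ?_)
        rwa [abs_sub_comm]
    calc |limUnder atTop (fun j : ℕ => R (2 ^ j * L)) - limUnder atTop (fun j : ℕ => R (2 ^ j * L'))| = |(limUnder atTop (fun j : ℕ => R (2 ^ j * L)) - limUnder atTop (fun j : ℕ => R (2 ^ j * N))) + (limUnder atTop (fun j : ℕ => R (2 ^ j * N)) - limUnder atTop (fun j : ℕ => R (2 ^ j * N'))) + (limUnder atTop (fun j : ℕ => R (2 ^ j * N')) - limUnder atTop (fun j : ℕ => R (2 ^ j * L')))| := by ring_nf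
      _ ≤ |limUnder atTop (fun j : ℕ => R (2 ^ j * L)) - limUnder atTop (fun j : ℕ => R (2 ^ j * N))| + |limUnder atTop (fun j : ℕ => R (2 ^ j * N)) - limUnder atTop (fun j : ℕ => R (2 ^ j * N'))| + |limUnder atTop (fun j : ℕ => R (2 ^ j * N')) - limUnder atTop (fun j : ℕ => R (2 ^ j * L'))| := abs_add_three _ _ _
      _ ≤ 2 * K * (L:ℝ) ^ (-θ) + ε + 2 * K * (L':ℝ) ^ (-θ) := by
          rw [abs_sub_comm] at hA; linarith
      _ = 2 * K * ((L:ℝ) ^ (-θ) + (L':ℝ) ^ (-θ)) + ε := by ring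
  -- `L^{-θ} → 0` along the naturals
  have hpow : Tendsto (fun L : ℕ => (L:ℝ) ^ (-θ)) atTop (𝓝 0) :=
    (tendsto_rpow_neg_atTop hθ).comp tendsto_natCast_atTop_atTop
  -- `towerLim 2 R` is Cauchy, hence converges
  have hcauchy : CauchySeq (fun L : ℕ => limUnder atTop (fun j : ℕ => R (2 ^ j * L))) := by
    refine Metric.cauchySeq_iff'.2 fun ε hε => ?_
    have hε' : 0 < ε / (4 * K + 1) := div_pos hε (by linarith)
    obtain ⟨L₁, hL₁⟩ := (Metric.tendsto_atTop.1 hpow) (ε / (4 * K + 1)) hε'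
    refine ⟨max L₁ 1, fun L hL => ?_⟩
    have hL1 : 1 ≤ L := le_trans (le_max_right _ _) hL
    have hM1 : 1 ≤ max L₁ 1 := le_max_right _ _
    have h1 : (L:ℝ) ^ (-θ) < ε / (4 * K + 1) := by
      have := hL₁ L (le_trans (le_max_left _ _) hL)
      rw [Real.dist_eq, sub_zero, abs_of_nonneg (Real.rpow_nonneg (Nat.cast_nonneg L) _)] at this
      exact this
    have h2 : ((max L₁ 1 : ℕ):ℝ) ^ (-θ) < ε / (4 * K + 1) := by
      have := hL₁ (max L₁ 1) (le_max_left _ _)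
      rw [Real.dist_eq, sub_zero, abs_of_nonneg (Real.rpow_nonneg (Nat.cast_nonneg _) _)] at this
      exact this
    rw [Real.dist_eq]
    calc |limUnder atTop (fun j : ℕ => R (2 ^ j * L)) - limUnder atTop (fun j : ℕ => R (2 ^ j * (max L₁ 1)))| ≤ 2 * K * ((L:ℝ) ^ (-θ) + ((max L₁ 1 : ℕ):ℝ) ^ (-θ)) := key L _ hL1 hM1
      _ ≤ 2 * K * (ε / (4 * K + 1) + ε / (4 * K + 1)) := by
          refine mul_le_mul_of_nonneg_left ?_ (by positivity); linarith
      _ = (4 * K) * (ε / (4 * K + 1)) := by ring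
      _ < (4 * K + 1) * (ε / (4 * K + 1)) := by
          refine mul_lt_mul_of_pos_right (by linarith) hε'
      _ = ε := by field_simp
  obtain ⟨M, hM⟩ := cauchySeq_tendsto_of_complete hcauchy
  refine ⟨M, ?_⟩
  -- `R − towerLim 2 R → 0`
  have hdiff : Tendsto (fun L : ℕ => R L - limUnder atTop (fun j : ℕ => R (2 ^ j * L))) atTop (𝓝 0) := by
    refine squeeze_zero_norm' ?_ (by simpa using hpow.const_mul C₂)
    filter_upwards [eventually_ge_atTop 1] with L hL
    simpa [Real.norm_eq_abs] using d2 L hL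
  have := hdiff.add hM
  simp only [sub_add_cancel, zero_add] at this
  exact this

end Summit.CriticalPhenomena.Ising3DConformalLimit.JoiningsTransferNegative

end
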